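import Summits.QuantumAdvantage.QuantumAdvantage.Theses.YangBaxterIslands

/-!
# Birth skeleton of piece `YbNotP` (∃ L ∈ XXZBQP, L ∉ P) — BC3 for the proposed child of `YbTarget`

Two named stubs and a sorry-free composition concluding the piece:
  stub_hardness : BQP ⊆ XXZBQP            (literally the route's crux `YbHardness`, stmt-QuantumAdvantage-2548, rank 3)
  stub_bqpNotP  : ∃ L ∈ BQP, L ∉ P          (programme-wide; a CONSEQUENCE of the summit — `Split.bqpNotP_of_summit`)
  YbNotP_of     : stub_hardness → stub_bqpNotP → YbNotP   (transport the BQP witness into the brickwork class).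
Concrete special case of stub_bqpNotP ∧ stub_hardness: L = FACT (tree theorem `FACT_mem_BQP_holds`) — "Shor on the
integrable brickwork" + `FACT ∉ P`.
-/

namespace Summit.QuantumAdvantage.QuantumAdvantage.Cruxes.YbTarget.BirthNotP

open Summit.QuantumAdvantage.QuantumAdvantage.Theses.YangBaxterIslands

/-- the piece (local copy; becomes the route decl `YangBaxterIslands.YbNotP` after the split) -/
def YbNotP : Prop :=
  ∃ L : Language Bool, (∃ a b : ℚ, ∃ (f : List Bool → List Bool) (p q : Polynomial ℕ), f ∈ Literature.Computability.Complexity.FP ∧ ∃ F : Literature.Computability.Cryptography.QCircuitFamily (⟨Unit, fun _ => 2, fun _ => Matrix.of fun u v : Fin 2 → Bool => if u 0 = u 1 then (if v = u then Complex.exp (-((((b : ℝ) * Real.pi) : ℝ) : ℂ) * Complex.I) else 0) else if v 0 = v 1 then 0 else Complex.exp (((((b : ℝ) * Real.pi) : ℝ) : ℂ) * Complex.I) * (if v = u then ((Real.cos (2 * ((a : ℝ) * Real.pi)) : ℝ) : ℂ) else -(Complex.I * ((Real.sin (2 * ((a : ℝ) * Real.pi)) : ℝ) : ℂ)))⟩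 : Literature.Computability.Cryptography.QGateSet), F = ⟨fun n => p.eval n, fun n => ⟨(List.range (q.eval n)).flatMap fun s => (List.range (n + p.eval n)).filterMap fun j => if h : j % 2 = s % 2 ∧ j + 1 < (n + p.eval n) then some (Literature.Computability.Cryptography.QGate.gate () ⟨fun i : Fin 2 => ⟨j + i.val, by have := i.isLt; omega⟩, fun i i' hh => Fin.ext (by simp only [Fin.mk.injEq] at hh; omega)⟩) else none⟩⟩ ∧ ∀ x : List Bool, (x ∈ L → (2 : ℝ) / 3 ≤ F.acceptProbOn 0 (f x)) ∧ (x ∉ L → F.acceptProbOn 0 (f x) ≤ 1 / 3)) ∧ L ∉ Literature.Computability.Complexity.Classes.P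

/-- STUB `stub_hardness` = the route crux `YbHardness` (BQP ⊆ XXZBQP: programmable universality of the integrable
qubit QCA with program + data in the product input). -/
theorem stub_hardness : Literature.Computability.Cryptography.BQP ⊆ {L : Language Bool | ∃ a b : ℚ, ∃ (f : List Bool → List Bool) (p q : Polynomial ℕ), f ∈ Literature.Computability.Complexity.FP ∧ ∃ F : Literature.Computability.Cryptography.QCircuitFamily (⟨Unit, fun _ => 2, fun _ => Matrix.of fun u v : Fin 2 → Bool => if u 0 = u 1 then (if v = u then Complex.exp (-((((b : ℝ) * Real.pi) : ℝ) : ℂ) * Complex.I) else 0) else if v 0 = v 1 then 0 else Complex.exp (((((b : ℝ) * Real.pi) : ℝ) : ℂ) * Complex.I) * (if v = u then ((Real.cos (2 * ((a : ℝ) * Real.pi)) : ℝ) : ℂ) else -(Complex.I * ((Real.sin (2 * ((a : ℝ) * Real.pi)) : ℝ) : ℂ)))⟩ : Literature.Computability.Cryptography.QGateSet), F = ⟨fun n => p.eval n, fun n => ⟨(List.range (q.eval n)).flatMap fun s => (List.range (n + p.eval n)).filterMap fun j => if h : j % 2 = s % 2 ∧ j + 1 < (n + p.eval n) then some (Literature.Computability.Cryptography.QGate.gate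 () ⟨fun i : Fin 2 => ⟨j + i.val, by have := i.isLt; omega⟩, fun i i' hh => Fin.ext (by simp only [Fin.mk.injEq] at hh; omega)⟩) else none⟩⟩ ∧ ∀ x : List Bool, (x ∈ L → (2 : ℝ) / 3 ≤ F.acceptProbOn 0 (f x)) ∧ (x ∉ L → F.acceptProbOn 0 (f x) ≤ 1 / 3)} := by
  sorry

/-- STUB `stub_bqpNotP`: `BQP ⊄ P` in witness form. Strictly weaker than the summit (`S → this` by `P ⊆ BPP`;
the converse is derandomization). -/
theorem stub_bqpNotP : ∃ L : Language Bool, L ∈ Literature.Computability.Cryptography.BQP ∧ L ∉ Literature.Computability.Complexity.Classes.P := by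
  sorry

/-- COMPOSITION (no sorry): hardness transports the `BQP ∖ P` witness into `XXZBQP ∖ P`. -/
theorem YbNotP_of :
    (Literature.Computability.Cryptography.BQP ⊆ {L : Language Bool | ∃ a b : ℚ, ∃ (f : List Bool → List Bool) (p q : Polynomial ℕ), f ∈ Literature.Computability.Complexity.FP ∧ ∃ F : Literature.Computability.Cryptography.QCircuitFamily (⟨Unit, fun _ => 2, fun _ => Matrix.of fun u v : Fin 2 → Bool => if u 0 = u 1 then (if v = u then Complex.exp (-((((b : ℝ) * Real.pi) : ℝ) : ℂ) * Complex.I) else 0) else if v 0 = v 1 then 0 else Complex.exp (((((b : ℝ) * Real.pi) : ℝ) : ℂ) * Complex.I) * (if v = u then ((Real.cos (2 * ((a : ℝ) * Real.pi)) : ℝ) : ℂ) else -(Complex.I * ((Real.sin (2 * ((a : ℝ) * Real.pi)) : ℝ) : ℂ)))⟩ : Literature.Computability.Cryptography.QGateSet), F = ⟨fun n => p.eval n, fun n => ⟨(List.range (q.eval n)).flatMap fun s => (List.range (n + p.eval n)).filterMap fun j => if h : j % 2 = s % 2 ∧ j + 1 < (n + p.eval n) then some (Literature.Computability.Cryptography.QGate.gate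 () ⟨fun i : Fin 2 => ⟨j + i.val, by have := i.isLt; omega⟩, fun i i' hh => Fin.ext (by simp only [Fin.mk.injEq] at hh; omega)⟩) else none⟩⟩ ∧ ∀ x : List Bool, (x ∈ L → (2 : ℝ) / 3 ≤ F.acceptProbOn 0 (f x)) ∧ (x ∉ L → F.acceptProbOn 0 (f x) ≤ 1 / 3)}) →
    (∃ L : Language Bool, L ∈ Literature.Computability.Cryptography.BQP ∧ L ∉ Literature.Computability.Complexity.Classes.P) →
    YbNotP := by
  intro hH hB
  obtain ⟨L, hL, hLP⟩ := hB
  exact ⟨L, hH hL, hLP⟩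

theorem YbNotP_of_stubs : YbNotP := YbNotP_of stub_hardness stub_bqpNotP

/-- sanity: `stub_hardness` is the route decl verbatim -/
example : (Literature.Computability.Cryptography.BQP ⊆ {L : Language Bool | ∃ a b : ℚ, ∃ (f : List Bool → List Bool) (p q : Polynomial ℕ), f ∈ Literature.Computability.Complexity.FP ∧ ∃ F : Literature.Computability.Cryptography.QCircuitFamily (⟨Unit, fun _ => 2, fun _ => Matrix.of fun u v : Fin 2 → Bool => if u 0 = u 1 then (if v = u then Complex.exp (-((((b : ℝ) * Real.pi) : ℝ) : ℂ) * Complex.I) else 0) else if v 0 = v 1 then 0 else Complex.exp (((((b : ℝ) * Real.pi) : ℝ) : ℂ) * Complex.I) * (if v = u then ((Real.cos (2 * ((a : ℝ) * Real.pi)) : ℝ) : ℂ) else -(Complex.I * ((Real.sin (2 * ((a : ℝ) * Real.pi)) : ℝ) : ℂ)))⟩ : Literature.Computability.Cryptography.QGateSet), F = ⟨fun n => p.eval n, fun n => ⟨(List.range (q.eval n)).flatMap fun s => (List.range (n + p.eval n)).filterMap fun j => if h : j % 2 = s % 2 ∧ j + 1 < (n + p.eval n) then some (Literature.Computability.Cryptography.QGate.gate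 () ⟨fun i : Fin 2 => ⟨j + i.val, by have := i.isLt; omega⟩, fun i i' hh => Fin.ext (by simp only [Fin.mk.injEq] at hh; omega)⟩) else none⟩⟩ ∧ ∀ x : List Bool, (x ∈ L → (2 : ℝ) / 3 ≤ F.acceptProbOn 0 (f x)) ∧ (x ∉ L → F.acceptProbOn 0 (f x) ≤ 1 / 3)}) ↔ YbHardness := Iff.rfl

end Summit.QuantumAdvantage.QuantumAdvantage.Cruxes.YbTarget.BirthNotP
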